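import Literature.RingTheory.CentralSimple.PositiveInvolutionModuleForms
import HarnessLib

/-!
# A subalgebra STABLE under a positive involution carries a positive involution; a stable commutative
# semisimple subalgebra is a product of totally real fields (on which the involution is the identity) and CM
# fields (on which it is complex conjugation) — Milne, *Complex Multiplication*, Ch. I §1 Prop. 1.37 and
# Prop. 1.39 / Cor. 1.40, read INSIDE an ambient positive pair `(D, ′)`

Family `hodge`, lane `lit-hodgefound` (Track 2 foundations library, Layer A3), seat `skel-3`, row **A3-G149**
(FILE 1 of the row: pure algebra). Topic `Literature/RingTheory/CentralSimple`, namespace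
`Literature.RingTheory.CentralSimple`. THEOREMS ONLY: no definition, no instance, no named fact, no notation
(D-0026, net debt 0).

Sequel, BY NAME (nothing restated), of
* `PositiveInvolutionModuleForms.lean` (Milne's Prop. 1.37: `HasInvariantPosDefForm ι V` = condition (14),
  `IsPositiveAntiInvolution.hasInvariantPosDefForm_self` = (c) ⟹ (a),
  `IsAntiInvolution.isPositiveAntiInvolution_of_hasInvariantPosDefForm` = (a) ⟹ (c) for ANY faithful module);
* `NumberTheory/ComplexMultiplication/CMAlgebraPositiveInvolution.lean` (Milne's Prop. 1.39 / Cor. 1.40 for a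
  COMMUTATIVE algebra `B ≅ ∏ᵢ Kᵢ` with a positive involution: `IsPositiveAntiInvolution.factorHom`,
  `apply_eq_factorHom`, `apply_symm_single(_one)`, `isTotallyReal_or_isCMField_factor`, `factorHom_eq_id_iff`,
  `isCMField_of_factorHom_ne_id`, `factorHom_eq_complexConj`, and `exists_ringEquiv_pi_numberField`,
  `algEquivOfRingEquiv`);
* `PositiveInvolutionSubfield.lean` (p22: the case of an embedded `′`-stable FIELD `f : K →ₐ[ℚ] D` —
  `IsPositiveAntiInvolution.of_algHom`, by an explicit trace transfer which needs `K` to be a field).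

## Sources, verbatim

J. S. Milne, *Complex Multiplication* (course notes, version of July 14, 2020; bib `MilneCM2006`), Ch. I §1, fetched
text `paper:url-8ccc30e4daab` p0020–p0021:

* **Proposition 1.37** «Let `B` be a finite-dimensional `ℚ`-algebra. The following conditions on an involution `′`
  of `B` are equivalent: (a) `B` is semisimple and some faithful `B`-module `V` admits a positive definite symmetric
  `ℚ`-bilinear form `( | ) : V × V → ℚ` such that `(bu|v) = (u|b′v)`, all `b ∈ B`, `u, v ∈ V`; (14) (b) every
  `B`-module admits a positive definite symmetric `ℚ`-bilinear form satisfying (14); (c) `′` is positive.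
  PROOF. (a)⟹(b). Every `B`-module is a direct summand of a direct sum of copies of `V` (see p. 8), and the
  restriction of a bilinear form as in (a) to a `B`-submodule is of the same type. […] (c)⟹(a). […] for `V` we
  can take `B` with `(u|v) = Tr_{B/ℚ}(uv′)`.»
* **Proposition 1.39** «Every finite-dimensional commutative `ℚ`-algebra with positive involution is a product of
  pairs as in (1.38)» [(1.38): «(a) For a totally real number field `F`, the identity involution is positive.
  (b) For a CM-field `E`, the involution `ι_E` is positive.»]; proof, footnote 11: «Case (b) [two factors
  interchanged by `′`] is excluded, for if `B = B₁ × B₂`, then `(a,0)(a,0)′ = (a,0)(0,a′) = 0`»; **Corollary 1.40**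
  «The CM-algebras are exactly the finite-dimensional commutative `ℚ`-algebras admitting a (unique) positive
  involution that acts nontrivially on each factor.»
* Ch. I §3 **Proposition 3.6** (p0028) «(a) […] We know that it is either totally real or CM because it is stable
  under the Rosati involutions (1.39)» — Prop. 1.39 is APPLIED there to a `′`-STABLE SUBALGEBRA of the positive pair
  `(End⁰(A), ′)`; the transfer of positivity to the stable subalgebra is (a)⟹(c) of Prop. 1.37 for the faithful
  module `V = End⁰(A)` with the form of (c)⟹(a).

## What is proved

§1 For finite-dimensional `ℚ`-algebras `B`, `D`, a positive anti-involution `σ` of `D` (`IsPositiveAntiInvolution D σ`: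
`Tr_{D/ℚ}(σ(x)x) > 0`) and an INJECTIVE algebra map `ρ : B →ₐ[ℚ] D` whose image is `σ`-stable:
* `exists_linearMap_apply_algHom_eq` / `linearMap_eq_of_apply_algHom_eq` — the pulled-back map `τ : B → B`,
  `σ(ρ b) = ρ(τ b)`, exists and is unique; `IsAntiInvolution.of_injective` — it is an anti-involution;
* ★★ **`IsPositiveAntiInvolution.of_injective`** — `(B, τ)` IS A POSITIVE PAIR: `D` carries the form
  `(u|v) = Tr(σ(u)v) + Tr(σ(v)u)` of (c)⟹(a) (`hasInvariantPosDefForm_self`), `D` is a FAITHFUL `B`-module through `ρ`,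
  and «the restriction of a bilinear form as in (a) … is of the same type»: `(ρ(b)u|v) = (u|σ(ρ b)v) = (u|ρ(τ b)v)`,
  so (a)⟹(c) (`isPositiveAntiInvolution_of_hasInvariantPosDefForm`) applies to `(B, τ)` and `V = D`;
* `IsPositiveAntiInvolution.apply_eq_self_of_isIdempotentElem` — footnote 11 in a non-commutative `D`: `σ` fixes
  every idempotent `e` which commutes with `σ(e)` (e.g. every idempotent of a `σ`-stable commutative subalgebra).

§2 For `B = ∏ᵢ Lᵢ` a finite product of number fields (the general commutative semisimple `B`, Prop. 1.39 read
inside `(D, σ)` along `AlgEquiv.refl`; `τᵢ = factorHom` the factor involutions):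
* `apply_map_piSingle_one` (`σ` fixes `ρ(eᵢ)`), **`apply_map_piSingle`** (`σ(ρ(0,…,y,…,0)) = ρ(0,…,τᵢ y,…,0)`:
  «preserves each factor»), `linearMap_piSingle`, `exists_apply_map_piSingle_eq`;
* **`isTotallyReal_or_isCMField_of_map_stable`** (each `Lᵢ` is totally real or CM),
  `forall_apply_map_piSingle_eq_iff_isTotallyReal` (`σ = id` on the factor ⟺ `Lᵢ` totally real),
  `isCMField_of_apply_map_piSingle_ne` (a factor MOVED by `σ` is CM), **`apply_map_piSingle_eq_complexConj`** (on a
  CM factor `σ` is complex conjugation), `apply_map_eq_map_complexConj` (all factors CM: `σ(ρ a) = ρ(ā)`),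
  ★ **`exists_isCMField_apply_map_eq_map_complexConj`** (every factor moved ⟹ every `Lᵢ` is CM and `σ ∘ ρ = ρ ∘ ‾`:
  Cor. 1.40 inside `(D, σ)`).

§3 Packaging for a `σ`-STABLE commutative reduced SUBALGEBRA `R ≤ D`: `exists_algEquiv_pi_numberField_of_comm_isReduced`
(`R ≅ ∏ᵢ Lᵢ`), ★★ **`IsPositiveAntiInvolution.exists_range_eq_of_stable`** (PROP. 1.39 RELATIVE TO `(D, σ)`: `R = ρ(∏ᵢ Lᵢ)`
with `σ(ρ a) = ρ(τ a)`, `τ` positive and factorwise, each factor `(Lᵢ, τᵢ)` = (totally real, `id`) or (CM,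
complex conjugation)), ★★ **`IsPositiveAntiInvolution.exists_isCMField_range_eq_of_stable`** (if moreover below every
non-zero idempotent `e ∈ R` some element of `eR` is moved by `σ`, then ALL `Lᵢ` are CM and `σ(ρ a) = ρ(ā)` — `R` «is
a CM-algebra on which `σ` is complex conjugation»).

The torus ∕ abelian-variety levels (Milne's Prop. 3.6 (c) «which can be chosen to be a CM-algebra invariant under
[the] Rosati involution» for the `R` of Exercise 3.10 (b)) are the sequel files of row A3-G149.

## References

* [MilneCM2006] J. S. Milne, *Complex Multiplication* (version July 14, 2020), Ch. I §1 Prop. 1.37, Prop. 1.39,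
  Cor. 1.40 (pp. 20–21); §3 Prop. 3.6 (p. 28).
* [Lange2023AbelianVarietiesComplex] H. Lange, *Abelian Varieties over the Complex Numbers* (2023), §2.6.2
  Lemma 2.6.4 (proof: positivity transferred to a stable commutative subalgebra), §5.1 Thm. 5.1.8.
* [Shimura1998] G. Shimura, *Abelian Varieties with Complex Multiplication and Modular Functions* (1998), §5.1
  Lemma 2 (p. 36), §17.3 (17.3i) (p. 117).

## Provenance

Lane `lit-hodgefound`, seat `literature-prover-lit-hodgefound-skel-3-g63-0` (row A3-G149, FILE 1).
-/

noncomputable section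

open Module
open scoped ComplexConjugate

namespace Literature.RingTheory.CentralSimple

open Literature.NumberTheory.Automorphic (leftMulTrace leftMulTrace_apply)
open Literature.NumberTheory.ComplexMultiplication (exists_ringEquiv_pi_numberField algEquivOfRingEquiv)
open NumberField

universe u v

/-! ## §1 Pulling a (positive) anti-involution back along an injective algebra map with stable image -/

section Transfer

variable {D : Type u} [Ring D] [Algebra ℚ D] {σ : D →ₗ[ℚ] D}
variable {B : Type v} [Ring B] [Algebra ℚ B]

/-- **The restricted involution exists**: if `σ` maps `ρ(B)` into itself and `ρ` is injective, there is a
`ℚ`-linear `τ : B → B` with `σ(ρ b) = ρ(τ b)` («the anti-involution restricted to» the stable subalgebra; the field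
case is the tree's `exists_linearMap_of_forall_apply_mem_range`). [cite: MilneCM2006, Ch. I §1 Prop. 1.39 (proof:
`B` «decomposes (as a `ℚ`-algebra with involution)», p. 20)] [cite: Lange2023AbelianVarietiesComplex, §2.6.1] -/
theorem exists_linearMap_apply_algHom_eq (ρ : B →ₐ[ℚ] D) (hρ : Function.Injective ρ)
    (hst : ∀ b, ∃ c, σ (ρ b) = ρ c) : ∃ τ : B →ₗ[ℚ] B, ∀ b, σ (ρ b) = ρ (τ b) := by
  choose τ hτ using hst
  refine ⟨{ toFun := τ, map_add' := fun a b ↦ hρ ?_, map_smul' := fun c a ↦ hρ ?_ }, hτ⟩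
  · rw [map_add, ← hτ, ← hτ, ← hτ, map_add, map_add]
  · rw [RingHom.id_apply, map_smul, ← hτ, ← hτ, map_smul, map_smul]

/-- With the image stated as membership in the range. [cite: MilneCM2006, Ch. I §1 Prop. 1.39 (proof, p. 20)] -/
theorem exists_linearMap_apply_algHom_eq_of_mem_range (ρ : B →ₐ[ℚ] D) (hρ : Function.Injective ρ)
    (hst : ∀ b, σ (ρ b) ∈ ρ.range) : ∃ τ : B →ₗ[ℚ] B, ∀ b, σ (ρ b) = ρ (τ b) :=
  exists_linearMap_apply_algHom_eq ρ hρ fun b ↦ by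
    obtain ⟨c, hc⟩ := (AlgHom.mem_range ρ).1 (hst b)
    exact ⟨c, hc.symm⟩

/-- The restricted map is unique (`ρ` is injective). [cite: MilneCM2006, Ch. I §1 Prop. 1.39 (proof, p. 20)] -/
theorem linearMap_eq_of_apply_algHom_eq (ρ : B →ₐ[ℚ] D) (hρ : Function.Injective ρ) {τ τ' : B →ₗ[ℚ] B}
    (hτ : ∀ b, σ (ρ b) = ρ (τ b)) (hτ' : ∀ b, σ (ρ b) = ρ (τ' b)) : τ = τ' :=
  LinearMap.ext fun b ↦ hρ (by rw [← hτ, hτ'])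

/-- **The restriction of an anti-involution to a stable subalgebra is an anti-involution** (`(ab)′ = b′a′`,
`a″ = a` pulled back along the injection `ρ`). [cite: MilneCM2006, Ch. I §1 (involutions, p. 19) and Prop. 1.39 (proof)] -/
theorem IsAntiInvolution.of_injective (h : IsAntiInvolution D σ) (ρ : B →ₐ[ℚ] D)
    (hρ : Function.Injective ρ) {τ : B →ₗ[ℚ] B} (hτ : ∀ b, σ (ρ b) = ρ (τ b)) : IsAntiInvolution B τ := by
  refine ⟨fun x y ↦ hρ ?_, fun x ↦ hρ ?_⟩
  · rw [← hτ, _root_.map_mul, h.map_mul, hτ, hτ, _root_.map_mul]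
  · rw [← hτ, ← hτ, h.apply_apply]

/-- **Footnote 11 in a non-commutative ambient algebra: a positive involution fixes every idempotent `e` that
commutes with its image `σ(e)`** — in particular every idempotent of a `σ`-stable COMMUTATIVE subalgebra («case (b)
[two factors interchanged by `′`] is excluded, for if `B = B₁ × B₂`, then `(a,0)(a,0)′ = 0`»).  With `f = σ(e)`,
`ef = fe`: `σ(e(1-f))·e(1-f) = (1-e)f·e(1-f) = 0`, so `e(1-f) = 0` by positivity; symmetrically `f(1-e) = 0`; hence
`σ(e) = f = fe = ef = e`.  (The commutative case is the tree's `IsPositiveAntiInvolution.apply_idempotent`.)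
[cite: MilneCM2006, Ch. I §1 Prop. 1.39 (proof, p. 20–21, footnote 11)] -/
theorem IsPositiveAntiInvolution.apply_eq_self_of_isIdempotentElem (h : IsPositiveAntiInvolution D σ) {e : D}
    (he : IsIdempotentElem e) (hc : Commute e (σ e)) : σ e = e := by
  set f := σ e with hf
  have hfe : σ f = e := by rw [hf, h.apply_apply]
  have h1 : σ (1 : D) = 1 := h.map_one
  have hee : e * e = e := he
  have hff : f * f = f := by rw [hf, ← h.map_mul, hee]
  have hc' : e * f = f * e := hc
  have he0 : (1 - e) * e = 0 := by rw [sub_mul, one_mul, hee, sub_self]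
  have hf0 : (1 - f) * f = 0 := by rw [sub_mul, one_mul, hff, sub_self]
  -- `e (1 - f) = 0`
  have hA : e * (1 - f) = 0 := by
    apply h.eq_zero_of_apply_mul_self
    have hσ : σ (e * (1 - f)) = (1 - e) * f := by rw [h.map_mul, map_sub, h1, hfe]
    rw [hσ]
    calc (1 - e) * f * (e * (1 - f)) = (1 - e) * (f * e) * (1 - f) := by simp only [mul_assoc]
      _ = (1 - e) * e * (f * (1 - f)) := by rw [← hc']; simp only [mul_assoc]
      _ = 0 := by rw [he0, zero_mul]
  -- `f (1 - e) = 0`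
  have hB : f * (1 - e) = 0 := by
    apply h.eq_zero_of_apply_mul_self
    have hσ : σ (f * (1 - e)) = (1 - f) * e := by rw [h.map_mul, map_sub, h1, hfe]
    rw [hσ]
    calc (1 - f) * e * (f * (1 - e)) = (1 - f) * (e * f) * (1 - e) := by simp only [mul_assoc]
      _ = (1 - f) * f * (e * (1 - e)) := by rw [hc']; simp only [mul_assoc]
      _ = 0 := by rw [hf0, zero_mul]
  have hA' : e * f = e := by
    rw [mul_sub, mul_one, sub_eq_zero] at hA
    exact hA.symm
  have hB' : f * e = f := by
    rw [mul_sub, mul_one, sub_eq_zero] at hB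
    exact hB.symm
  calc σ e = f := rfl
    _ = f * e := hB'.symm
    _ = e * f := hc'.symm
    _ = e := hA'

variable [Module.Finite ℚ D]

/-- ★★ **A `σ`-STABLE SUBALGEBRA OF A POSITIVE PAIR IS A POSITIVE PAIR** (Prop. 1.37 (c)⟹(a)⟹(c), run for the faithful
`B`-module `V = D`): if `σ` is a positive anti-involution of the finite-dimensional `D` and `ρ : B → D` an injective
algebra map with `σ(ρ b) = ρ(τ b)`, then `τ` is a POSITIVE anti-involution of `B`, `Tr_{B/ℚ}(τ(b)b) > 0` for `b ≠ 0`.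
Proof: by (c)⟹(a) `D` admits a positive definite symmetric form with `(du|v) = (u|σ(d)v)`
(`hasInvariantPosDefForm_self`); `D` is a faithful `B`-module through `ρ` («the restriction … is of the same type»:
`(ρ(b)u|v) = (u|σ(ρ b)v) = (u|ρ(τ b)v)`), so (a)⟹(c) (`isPositiveAntiInvolution_of_hasInvariantPosDefForm`) gives the
positivity of `τ`.  The embedded-FIELD case is the tree's `IsPositiveAntiInvolution.of_algHom`; Milne applies the
statement in the proof of Prop. 3.6 (a) («it is stable under the Rosati involutions (1.39)»).
[cite: MilneCM2006, Ch. I §1 Prop. 1.37 (a)⟹(b)⟹(c) and (c)⟹(a) (p. 20); §3 Prop. 3.6 (a) (proof, p. 28)]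
[cite: Lange2023AbelianVarietiesComplex, §2.6.2 Lemma 2.6.4 (proof)] -/
theorem IsPositiveAntiInvolution.of_injective (h : IsPositiveAntiInvolution D σ) (ρ : B →ₐ[ℚ] D)
    (hρ : Function.Injective ρ) {τ : B →ₗ[ℚ] B} (hτ : ∀ b, σ (ρ b) = ρ (τ b)) :
    IsPositiveAntiInvolution B τ := by
  haveI : Module.Finite ℚ B := Module.Finite.of_injective ρ.toLinearMap hρ
  -- `D` as a faithful `B`-module through `ρ`: `b • d = ρ b * d`
  letI : Module B D := Module.compHom D (ρ : B →+* D)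
  have hsmul : ∀ (b : B) (d : D), b • d = ρ b * d := fun _ _ ↦ rfl
  haveI : FaithfulSMul B D := ⟨fun {b₁ b₂} hb ↦ hρ (by
    have h1 := hb 1
    rwa [hsmul, hsmul, mul_one, mul_one] at h1)⟩
  -- the form of (c)⟹(a) on `D` satisfies (14) for `(B, τ)`
  have hV : HasInvariantPosDefForm τ D := by
    obtain ⟨β, hsymm, hpos, h14⟩ := h.hasInvariantPosDefForm_self
    refine ⟨β, hsymm, hpos, fun b u v ↦ ?_⟩
    have h := h14 (ρ b) u v
    rw [smul_eq_mul, smul_eq_mul, hτ] at h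
    rw [hsmul, hsmul]
    exact h
  exact (h.toIsAntiInvolution.of_injective ρ hρ hτ).isPositiveAntiInvolution_of_hasInvariantPosDefForm hV

/-- The positive pair on a stable subalgebra, existence form: `∃ τ` positive with `σ ∘ ρ = ρ ∘ τ`.
[cite: MilneCM2006, Ch. I §1 Prop. 1.37 (p. 20)] -/
theorem IsPositiveAntiInvolution.exists_of_injective (h : IsPositiveAntiInvolution D σ) (ρ : B →ₐ[ℚ] D)
    (hρ : Function.Injective ρ) (hst : ∀ b, ∃ c, σ (ρ b) = ρ c) :
    ∃ τ : B →ₗ[ℚ] B, IsPositiveAntiInvolution B τ ∧ ∀ b, σ (ρ b) = ρ (τ b) := by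
  obtain ⟨τ, hτ⟩ := exists_linearMap_apply_algHom_eq ρ hρ hst
  exact ⟨τ, h.of_injective ρ hρ hτ, hτ⟩

end Transfer

/-! ## §2 A stable product of number fields `ρ : ∏ᵢ Lᵢ ↪ D`: Prop. 1.39 / Cor. 1.40 inside `(D, σ)` -/

section Pi

variable {D : Type u} [Ring D] [Algebra ℚ D] [Module.Finite ℚ D] {σ : D →ₗ[ℚ] D}
variable {t : Type v} [Fintype t] [DecidableEq t] {L : t → Type v} [∀ i, Field (L i)] [∀ i, NumberField (L i)]
  {ρ : (Π i, L i) →ₐ[ℚ] D} {τ : (Π i, L i) →ₗ[ℚ] (Π i, L i)}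
variable (h : IsPositiveAntiInvolution D σ) (hρ : Function.Injective ρ) (hτ : ∀ a, σ (ρ a) = ρ (τ a))

include h hρ hτ

omit [Fintype t] in
/-- **`σ` fixes the idempotents `ρ(eᵢ)`, `eᵢ = (0,…,1,…,0)`** («`′` preserves each factor», case (b) excluded): the
tree's `apply_symm_single_one` for the positive pair `(∏ᵢ Lᵢ, τ)` of §1, along `AlgEquiv.refl`.
[cite: MilneCM2006, Ch. I §1 Prop. 1.39 (proof, p. 20–21, footnote 11)] -/
theorem IsPositiveAntiInvolution.apply_map_piSingle_one (i : t) :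
    σ (ρ (Pi.single i 1)) = ρ (Pi.single i 1) := by
  rw [hτ]
  congr 1
  exact (h.of_injective ρ hρ hτ).apply_symm_single_one AlgEquiv.refl i

omit [Fintype t] in
/-- The pulled-back involution read on a coordinate: `(τ a)ᵢ = τᵢ(aᵢ)` with `τᵢ` the factor involution
(`factorHom … AlgEquiv.refl i`). [cite: MilneCM2006, Ch. I §1 Prop. 1.39 (proof, p. 20–21)] -/
theorem IsPositiveAntiInvolution.linearMap_apply_eq_factorHom (a : Π i, L i) (i : t) :
    τ a i = (h.of_injective ρ hρ hτ).factorHom AlgEquiv.refl i (a i) :=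
  (h.of_injective ρ hρ hτ).apply_eq_factorHom AlgEquiv.refl a i

omit [Fintype t] in
/-- `τ(0,…,y,…,0) = (0,…,τᵢ y,…,0)`. [cite: MilneCM2006, Ch. I §1 Prop. 1.39 (proof, p. 20–21)] -/
theorem IsPositiveAntiInvolution.linearMap_piSingle (i : t) (y : L i) :
    τ (Pi.single i y) = Pi.single i ((h.of_injective ρ hρ hτ).factorHom AlgEquiv.refl i y) :=
  (h.of_injective ρ hρ hτ).apply_symm_single AlgEquiv.refl i y

omit [Fintype t] in
/-- ★ **`σ` PRESERVES EACH FACTOR `ρ(Lᵢeᵢ)` AND ACTS THERE THROUGH THE FACTOR INVOLUTION**: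
`σ(ρ(0,…,y,…,0)) = ρ(0,…,τᵢ y,…,0)` — «`B` decomposes (as a `ℚ`-algebra with involution) into a product each of whose
factors is … a simple algebra with an involution». [cite: MilneCM2006, Ch. I §1 Prop. 1.39 (proof, p. 20–21)] -/
theorem IsPositiveAntiInvolution.apply_map_piSingle (i : t) (y : L i) :
    σ (ρ (Pi.single i y)) = ρ (Pi.single i ((h.of_injective ρ hρ hτ).factorHom AlgEquiv.refl i y)) := by
  rw [hτ, h.linearMap_piSingle hρ hτ i y]

omit [Fintype t] in
/-- Each factor is `σ`-stable: `σ(ρ(0,…,y,…,0)) = ρ(0,…,y′,…,0)` for some `y′ ∈ Lᵢ`.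
[cite: MilneCM2006, Ch. I §1 Prop. 1.39 (proof, p. 20–21)] -/
theorem IsPositiveAntiInvolution.exists_apply_map_piSingle_eq (i : t) (y : L i) :
    ∃ y' : L i, σ (ρ (Pi.single i y)) = ρ (Pi.single i y') :=
  ⟨_, h.apply_map_piSingle hρ hτ i y⟩

/-- ★ **EACH FACTOR OF A `σ`-STABLE `ρ(∏ᵢ Lᵢ) ⊆ D` IS TOTALLY REAL OR CM** («the only possibilities for the factors
are `(ℝ, id)` or `(ℂ, ι)` … `B` is totally real … [or] a CM-field»: Shimura's Lemma 2 on the positive pair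
`(Lᵢ, τᵢ)`).  The case `D = End⁰(A)`, `σ` a Rosati involution, is «it is either totally real or CM because it is
stable under the Rosati involutions (1.39)». [cite: MilneCM2006, Ch. I §1 Prop. 1.39 (p. 20–21); §3 Prop. 3.6 (a) (proof, p. 28)]
[cite: Shimura1998, §5.1 Lemma 2 (p. 36)] -/
theorem IsPositiveAntiInvolution.isTotallyReal_or_isCMField_of_map_stable (i : t) :
    IsTotallyReal (L i) ∨ IsCMField (L i) :=
  (h.of_injective ρ hρ hτ).isTotallyReal_or_isCMField_factor AlgEquiv.refl i

/-- **`σ` is the identity on the factor `ρ(Lᵢeᵢ)` iff `Lᵢ` is totally real** («If they are `(ℝ, id)`, `B` is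
totally real and `′ = id`»). [cite: MilneCM2006, Ch. I §1 Prop. 1.39 (proof, p. 21)] -/
theorem IsPositiveAntiInvolution.forall_apply_map_piSingle_eq_iff_isTotallyReal (i : t) :
    (∀ y : L i, σ (ρ (Pi.single i y)) = ρ (Pi.single i y)) ↔ IsTotallyReal (L i) := by
  rw [← (h.of_injective ρ hρ hτ).factorHom_eq_id_iff AlgEquiv.refl i]
  constructor
  · intro hall
    refine RingHom.ext fun y ↦ ?_
    have hy := hall y
    rw [h.apply_map_piSingle hρ hτ i y] at hy
    have hy' := congrArg (fun a : Π i, L i ↦ a i) (hρ hy)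
    simpa only [Pi.single_eq_same, RingHom.id_apply] using hy'
  · intro hid y
    rw [h.apply_map_piSingle hρ hτ i y, hid, RingHom.id_apply]

/-- **A factor moved by `σ` is a CM field** («if they are `(ℂ, ι)`, `B` is a CM-field and `′ = ι`»).
[cite: MilneCM2006, Ch. I §1 Prop. 1.39 (proof, p. 21), Cor. 1.40] -/
theorem IsPositiveAntiInvolution.isCMField_of_apply_map_piSingle_ne (i : t) {y : L i}
    (hne : σ (ρ (Pi.single i y)) ≠ ρ (Pi.single i y)) : IsCMField (L i) := by
  refine (h.of_injective ρ hρ hτ).isCMField_of_factorHom_ne_id AlgEquiv.refl i fun hid ↦ hne ?_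
  rw [h.apply_map_piSingle hρ hτ i y, hid, RingHom.id_apply]

/-- The converse: on a CM factor `σ` moves some element (it is complex conjugation, `≠ id`).
[cite: MilneCM2006, Ch. I §1 Cor. 1.40 («acts nontrivially on each factor»)] -/
theorem IsPositiveAntiInvolution.exists_apply_map_piSingle_ne (i : t) [IsCMField (L i)] :
    ∃ y : L i, σ (ρ (Pi.single i y)) ≠ ρ (Pi.single i y) := by
  by_contra hall
  push Not at hall
  exact Literature.NumberTheory.ComplexMultiplication.not_isTotallyReal_of_isCMField (L i)
    ((h.forall_apply_map_piSingle_eq_iff_isTotallyReal hρ hτ i).1 hall)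

/-- **`Lᵢ` is CM iff `σ` moves some element of the factor `ρ(Lᵢeᵢ)`** (Cor. 1.40 factorwise).
[cite: MilneCM2006, Ch. I §1 Cor. 1.40 (p. 21)] -/
theorem IsPositiveAntiInvolution.isCMField_iff_exists_apply_map_piSingle_ne (i : t) :
    IsCMField (L i) ↔ ∃ y : L i, σ (ρ (Pi.single i y)) ≠ ρ (Pi.single i y) :=
  ⟨fun _ ↦ h.exists_apply_map_piSingle_ne hρ hτ i, fun ⟨_, hne⟩ ↦ h.isCMField_of_apply_map_piSingle_ne hρ hτ i hne⟩

/-- ★ **ON A CM FACTOR `σ` IS COMPLEX CONJUGATION**: `σ(ρ(0,…,y,…,0)) = ρ(0,…,ȳ,…,0)` («if they are `(ℂ, ι)`, …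
`′ = ι`»; Shimura: «`ξ^{ρτ}` is the complex conjugate of `ξ^τ`»). [cite: MilneCM2006, Ch. I §1 Prop. 1.39 (proof, p. 21)]
[cite: Shimura1998, §5.1 Lemma 2 (p. 36)] -/
theorem IsPositiveAntiInvolution.apply_map_piSingle_eq_complexConj (i : t) [IsCMField (L i)] (y : L i) :
    σ (ρ (Pi.single i y)) = ρ (Pi.single i (IsCMField.complexConj (L i) y)) := by
  rw [h.apply_map_piSingle hρ hτ i y, (h.of_injective ρ hρ hτ).factorHom_eq_complexConj AlgEquiv.refl i y]

/-- **All factors CM: `σ(ρ a) = ρ(ā)`**, `ā = (ȳᵢ)ᵢ` the complex conjugation of the CM-algebra `∏ᵢ Lᵢ` (the tree's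
`piComplexConj L a`, coordinatewise). [cite: MilneCM2006, Ch. I §1 Cor. 1.40 (p. 21)] -/
theorem IsPositiveAntiInvolution.apply_map_eq_map_complexConj [∀ i, IsCMField (L i)] (a : Π i, L i) :
    σ (ρ a) = ρ (fun i ↦ IsCMField.complexConj (L i) (a i)) := by
  rw [hτ]
  congr 1
  funext i
  rw [h.linearMap_apply_eq_factorHom hρ hτ a i, (h.of_injective ρ hρ hτ).factorHom_eq_complexConj AlgEquiv.refl i]

/-- ★★ **COROLLARY 1.40 INSIDE `(D, σ)`: if `σ` moves every factor of the stable `ρ(∏ᵢ Lᵢ)`, then every `Lᵢ` is a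
CM FIELD and `σ` is the complex conjugation of the CM-algebra `∏ᵢ Lᵢ`**, `σ(ρ a) = ρ(ā)` («The CM-algebras are
exactly the finite-dimensional commutative `ℚ`-algebras admitting a (unique) positive involution that acts
nontrivially on each factor»). [cite: MilneCM2006, Ch. I §1 Cor. 1.40 (p. 21)] -/
theorem IsPositiveAntiInvolution.exists_isCMField_apply_map_eq_map_complexConj
    (hne : ∀ i, ∃ y : L i, σ (ρ (Pi.single i y)) ≠ ρ (Pi.single i y)) :
    ∃ _ : ∀ i, IsCMField (L i), ∀ a : Π i, L i, σ (ρ a) = ρ (fun i ↦ IsCMField.complexConj (L i) (a i)) := by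
  have hCM : ∀ i, IsCMField (L i) := fun i ↦ by
    obtain ⟨y, hy⟩ := hne i
    exact h.isCMField_of_apply_map_piSingle_ne hρ hτ i hy
  exact ⟨hCM, fun a ↦ h.apply_map_eq_map_complexConj hρ hτ a⟩

end Pi

/-! ## §3 A `σ`-stable commutative reduced SUBALGEBRA `R ≤ D` -/

section SubalgebraForms

variable {D : Type u} [Ring D] [Algebra ℚ D] [Module.Finite ℚ D] {σ : D →ₗ[ℚ] D}

/-- **A commutative reduced subalgebra of a finite-dimensional `ℚ`-algebra is, as a `ℚ`-algebra, a finite product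
of number fields** `∏_𝔪 R/𝔪 ≅ R` («`B` decomposes … into a product each of whose factors is … simple»; the tree's
`exists_ringEquiv_pi_numberField` for the commutative ring structure `hcomm` puts on `R`; the matrix-algebra case is
p19's `exists_algEquiv_pi_numberField_of_comm_isReduced`). [cite: MilneCM2006, Ch. I §1 Prop. 1.39 (proof, p. 20–21)] -/
theorem exists_algEquiv_pi_numberField_of_comm_isReduced (R : Subalgebra ℚ D) [IsReduced R]
    (hcomm : ∀ a ∈ R, ∀ b ∈ R, a * b = b * a) :
    ∃ (t : Type u) (_ : Fintype t) (L : t → Type u) (_ : ∀ i, Field (L i)) (_ : ∀ i, NumberField (L i)),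
      Nonempty ((Π i, L i) ≃ₐ[ℚ] R) := by
  letI : CommRing R :=
    { (inferInstance : Ring R) with mul_comm := fun x y ↦ Subtype.ext (hcomm x x.2 y y.2) }
  obtain ⟨n, iFt, K, iF, iNF, ⟨e⟩⟩ := exists_ringEquiv_pi_numberField R
  exact ⟨n, iFt, K, iF, iNF, ⟨algEquivOfRingEquiv e.symm⟩⟩

/-- A commutative reduced subalgebra `R ≤ D` is the (bijective) image of an INJECTIVE algebra map
`ρ : ∏ᵢ Lᵢ → D` from a product of number fields, `ρ(∏ᵢ Lᵢ) = R`. [cite: MilneCM2006, Ch. I §1 Prop. 1.39 (proof, p. 20–21)] -/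
theorem exists_injective_range_eq_of_comm_isReduced (R : Subalgebra ℚ D) [IsReduced R]
    (hcomm : ∀ a ∈ R, ∀ b ∈ R, a * b = b * a) :
    ∃ (t : Type u) (_ : Fintype t) (L : t → Type u) (_ : ∀ i, Field (L i)) (_ : ∀ i, NumberField (L i))
      (ρ : (Π i, L i) →ₐ[ℚ] D), Function.Injective ρ ∧ ρ.range = R := by
  obtain ⟨t, iFt, L, iF, iNF, ⟨ψ⟩⟩ := exists_algEquiv_pi_numberField_of_comm_isReduced R hcomm
  have hρ : ∀ a, R.val.comp (ψ : (Π i, L i) →ₐ[ℚ] R) a = ((ψ a : R) : D) := fun _ ↦ rfl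
  refine ⟨t, iFt, L, iF, iNF, R.val.comp (ψ : (Π i, L i) →ₐ[ℚ] R), fun a b hab ↦ ?_, ?_⟩
  · rw [hρ, hρ] at hab
    exact ψ.injective (Subtype.ext hab)
  · ext x
    rw [AlgHom.mem_range]
    constructor
    · rintro ⟨a, rfl⟩
      rw [hρ]
      exact (ψ a).2
    · intro hx
      exact ⟨ψ.symm ⟨x, hx⟩, by rw [hρ, AlgEquiv.apply_symm_apply]⟩

/-- ★★ **PROPOSITION 1.39 RELATIVE TO A POSITIVE PAIR `(D, σ)`**: a `σ`-STABLE commutative reduced (= semisimple)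
subalgebra `R ≤ D` is the image `R = ρ(∏ᵢ Lᵢ)` of an injective algebra map from a finite product of number fields
along which `σ` pulls back to a POSITIVE anti-involution `τ` of `∏ᵢ Lᵢ` (`σ(ρ a) = ρ(τ a)`, §1) acting FACTORWISE
through ring involutions `τᵢ` (`(τ a)ᵢ = τᵢ(aᵢ)`), each factor being either a totally real field with `τᵢ = id` or a
CM field with `τᵢ =` complex conjugation («a product of pairs as in (1.38)»).
[cite: MilneCM2006, Ch. I §1 Prop. 1.37, Prop. 1.39 (p. 20–21); §3 Prop. 3.6 (a) (proof, p. 28)] -/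
theorem IsPositiveAntiInvolution.exists_range_eq_of_stable (h : IsPositiveAntiInvolution D σ)
    (R : Subalgebra ℚ D) [IsReduced R] (hcomm : ∀ a ∈ R, ∀ b ∈ R, a * b = b * a) (hst : ∀ a ∈ R, σ a ∈ R) :
    ∃ (t : Type u) (_ : Fintype t) (L : t → Type u) (_ : ∀ i, Field (L i)) (_ : ∀ i, NumberField (L i))
      (ρ : (Π i, L i) →ₐ[ℚ] D) (τ : (Π i, L i) →ₗ[ℚ] (Π i, L i)) (f : ∀ i, L i →+* L i),
      Function.Injective ρ ∧ ρ.range = R ∧ IsPositiveAntiInvolution (Π i, L i) τ ∧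
        (∀ a, σ (ρ a) = ρ (τ a)) ∧ (∀ a i, τ a i = f i (a i)) ∧
        ∀ i, (IsTotallyReal (L i) ∧ f i = RingHom.id (L i)) ∨
          (∃ _ : IsCMField (L i), ∀ y, f i y = IsCMField.complexConj (L i) y) := by
  classical
  obtain ⟨t, iFt, L, iF, iNF, ρ, hρ, hR⟩ := exists_injective_range_eq_of_comm_isReduced R hcomm
  have hst' : ∀ b, ∃ c, σ (ρ b) = ρ c := fun b ↦ by
    have hb : σ (ρ b) ∈ R := hst _ (hR ▸ AlgHom.mem_range_self ρ b)
    rw [← hR, AlgHom.mem_range] at hb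
    obtain ⟨c, hc⟩ := hb
    exact ⟨c, hc.symm⟩
  obtain ⟨τ, hτ⟩ := exists_linearMap_apply_algHom_eq ρ hρ hst'
  have hB := h.of_injective ρ hρ hτ
  refine ⟨t, iFt, L, iF, iNF, ρ, τ, fun i ↦ hB.factorHom AlgEquiv.refl i, hρ, hR, hB, hτ,
    fun a i ↦ h.linearMap_apply_eq_factorHom hρ hτ a i, fun i ↦ ?_⟩
  rcases hB.isTotallyReal_or_isCMField_factor AlgEquiv.refl i with hRl | hC
  · exact Or.inl ⟨hRl, (hB.factorHom_eq_id_iff AlgEquiv.refl i).2 hRl⟩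
  · exact Or.inr ⟨hC, fun y ↦ hB.factorHom_eq_complexConj AlgEquiv.refl i y⟩

/-- ★★ **COROLLARY 1.40 RELATIVE TO `(D, σ)`: a `σ`-stable commutative reduced `R ≤ D` such that below every non-zero
idempotent `e ∈ R` some element of `eR` is MOVED by `σ` is a CM-ALGEBRA ON WHICH `σ` IS COMPLEX CONJUGATION** —
`R = ρ(∏ᵢ Lᵢ)` with every `Lᵢ` a CM field and `σ(ρ a) = ρ(ā)` («admitting a … positive involution that acts
nontrivially on each factor»).  The hypothesis is how the levels above say «non-trivial on each factor» without
naming the factors (Deligne: «`h(i)* = -h(i)`. The Rosati involution therefore is non-trivial on `E`»).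
[cite: MilneCM2006, Ch. I §1 Cor. 1.40 (p. 21)] [cite: Deligne1982HodgeCycles, I Prop. 5.1 (proof)] -/
theorem IsPositiveAntiInvolution.exists_isCMField_range_eq_of_stable (h : IsPositiveAntiInvolution D σ)
    (R : Subalgebra ℚ D) [IsReduced R] (hcomm : ∀ a ∈ R, ∀ b ∈ R, a * b = b * a) (hst : ∀ a ∈ R, σ a ∈ R)
    (hmove : ∀ e ∈ R, IsIdempotentElem e → e ≠ 0 → ∃ a ∈ R, e * a = a ∧ σ a ≠ a) :
    ∃ (t : Type u) (_ : Fintype t) (L : t → Type u) (_ : ∀ i, Field (L i)) (_ : ∀ i, NumberField (L i))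
      (_ : ∀ i, IsCMField (L i)) (ρ : (Π i, L i) →ₐ[ℚ] D),
      Function.Injective ρ ∧ ρ.range = R ∧ ∀ a, σ (ρ a) = ρ (fun i ↦ IsCMField.complexConj (L i) (a i)) := by
  classical
  obtain ⟨t, iFt, L, iF, iNF, ρ, hρ, hR⟩ := exists_injective_range_eq_of_comm_isReduced R hcomm
  have hmem : ∀ b, ρ b ∈ R := fun b ↦ hR ▸ AlgHom.mem_range_self ρ b
  have hst' : ∀ b, ∃ c, σ (ρ b) = ρ c := fun b ↦ by
    have hb : σ (ρ b) ∈ R := hst _ (hmem b)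
    rw [← hR, AlgHom.mem_range] at hb
    obtain ⟨c, hc⟩ := hb
    exact ⟨c, hc.symm⟩
  obtain ⟨τ, hτ⟩ := exists_linearMap_apply_algHom_eq ρ hρ hst'
  have hne : ∀ i, ∃ y : L i, σ (ρ (Pi.single i y)) ≠ ρ (Pi.single i y) := by
    intro i
    have hidem : IsIdempotentElem (ρ (Pi.single i (1 : L i))) := by
      change ρ (Pi.single i 1) * ρ (Pi.single i 1) = ρ (Pi.single i 1)
      rw [← map_mul, ← Pi.single_mul, mul_one]
    have hne0 : ρ (Pi.single i (1 : L i)) ≠ 0 := fun h0 ↦ by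
      have h1 : Pi.single i (1 : L i) = 0 := hρ (by rw [h0, map_zero])
      exact (one_ne_zero (α := L i)) (by simpa using congrArg (fun a : Π i, L i ↦ a i) h1)
    obtain ⟨a, haR, hea, hσa⟩ := hmove _ (hmem _) hidem hne0
    obtain ⟨c, rfl⟩ : ∃ c, ρ c = a := by
      have ha : a ∈ ρ.range := hR ▸ haR
      exact (AlgHom.mem_range ρ).1 ha
    have hc : c = Pi.single i (c i) := by
      have h1 : Pi.single i 1 * c = c := hρ (by rw [map_mul, hea])
      rw [← h1]
      ext j
      rcases eq_or_ne j i with rfl | hj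
      · rw [Pi.mul_apply, Pi.single_eq_same, Pi.single_eq_same, one_mul]
      · rw [Pi.mul_apply, Pi.single_eq_of_ne hj, Pi.single_eq_of_ne hj, zero_mul]
    exact ⟨c i, fun heq ↦ hσa (by rw [hc]; exact heq)⟩
  obtain ⟨hCM, hconj⟩ := h.exists_isCMField_apply_map_eq_map_complexConj hρ hτ hne
  exact ⟨t, iFt, L, iF, iNF, hCM, ρ, hρ, hR, hconj⟩

end SubalgebraForms


/-! ## §4 (edition 3 — cell `hodgecm-mathlib`, seat A-p04 (g13), 2026-08-29) Semisimplicity of `′`-stable subalgebras and of `ℚ[S]`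
for a `′`-stable set `S` — the direct route

RESTORATION NOTE.  Edition 2 of this file (p742190, same seat) was filed as a NEW file by mistake and REPLACED §§1–3 above (p710872,
lane `lit-hodgefound` skel-3, row A3-G149); this edition restores §§1–3 BYTE-IDENTICALLY from the author's copy
(`run/shared/lean/pub/lit-hodgefound/lit-hodgefound-skel-3/drafts-g63/PositiveInvolutionStableSubalgebra.p710872.lean`, sha256 =
the gate's `verify_target_sha` 7bb126c5…c1e of p742190) and appends edition 2's four theorems unchanged.

Content of §4: for a finite-dimensional `(D, ′)` with positive anti-involution, every `′`-stable `ℚ`-subalgebra `R ≤ D` is semisimple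
(`IsPositiveAntiInvolution.isSemisimpleRing_subalgebra`) — the two-line consequence «restrict `a′a = 0 ⇒ a = 0`, apply the nilpotent-radical
core ★ `InverseMonoidAlgebra.isSemisimpleRing_of_star_mul_self`»; the finer statement that `(R, ′|_R)` is itself a POSITIVE pair is §1's
`IsPositiveAntiInvolution.of_injective` (Milne Prop. 1.37, via invariant positive-definite forms), from which semisimplicity also follows by
★ `IsPositiveAntiInvolution.isSemisimpleRing`.  And the `ℚ`-algebra `ℚ[S]` generated by a set with `S′ ⊆ ℚ[S]` is `′`-stable
(`IsAntiInvolution.apply_mem_adjoin_of_forall_mem`), hence semisimple (`isSemisimpleRing_adjoin`, `_of_mapsTo`) — the form the cell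
`hodgecm-mathlib` consumes (d6 line, DEF request DH2: the level-`K` Hecke algebra image inside `End⁰(Alb X_K ×_E ℂ)` with the Rosati
involution ★ `HodgeTheory.AbelianVariety.rosati`, Hecke correspondences `[KgK]` with «`[KgK]′ ∈ ℚ[S]`» as hypothesis).  (The sentence in
`isSemisimpleRing_subalgebra`'s docstring that the trace positivity «need not restrict» is superseded by §1: it does, by Prop. 1.37; the
proof below simply does not use it.)  HC_CM is proved only modulo the 7 printed citations until rung 0 closes; nothing here moves a book.
[cite: MumfordAV1970, §21 Thm. 1] [cite: MilneCM2006, Ch. I §1 Prop. 1.36–1.37 (p. 20–21)] -/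

section StableAdjoin

variable {D : Type u} [Ring D] [Algebra ℚ D] {ι : D →ₗ[ℚ] D}

/-! ### §4.1 Stability of generated subalgebras -/

/-- **`ℚ[S]` is stable under an anti-involution stabilising `S`** (more generally: sending `S` into `ℚ[S]`): `'` is additive, `ℚ`-linear,
unital (`1' = 1`, ★ `IsAntiInvolution.map_one`) and product-reversing, and `Algebra.adjoin ℚ S` is closed under sums, scalars, `1` and
products in either order (`Algebra.adjoin_induction`). [cite: Lange2023AbelianVarietiesComplex, §2.6.2 (anti-involutions, PDF p. 139)]
[cite: MumfordAV1970, §21 (positive involutions)] -/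
theorem IsAntiInvolution.apply_mem_adjoin_of_forall_mem (h : IsAntiInvolution D ι) {S : Set D}
    (hS : ∀ s ∈ S, ι s ∈ Algebra.adjoin ℚ S) {x : D} (hx : x ∈ Algebra.adjoin ℚ S) :
    ι x ∈ Algebra.adjoin ℚ S := by
  induction hx using Algebra.adjoin_induction with
  | mem s hs => exact hS s hs
  | algebraMap r =>
    rw [Algebra.algebraMap_eq_smul_one, map_smul, h.map_one]
    exact Subalgebra.smul_mem _ (Subalgebra.one_mem _) r
  | add a b _ _ ha hb =>
    rw [map_add]
    exact Subalgebra.add_mem _ ha hb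
  | mul a b _ _ ha hb =>
    rw [h.map_mul]
    exact Subalgebra.mul_mem _ hb ha

/-! ### §4.2 Semisimplicity of stable subalgebras -/

/-- **A `ℚ`-subalgebra stable under a positive anti-involution is semisimple** ([MumfordAV1970] §21 Thm. 1 / [MilneCM2006] Prop. 1.36 for
the subalgebra): for `(D, ')` a finite-dimensional `ℚ`-algebra with positive anti-involution and `R ≤ D` with `R' ⊆ R`, `R` is semisimple
— `R` is artinian (finite-dimensional), `'|_R` is a product-reversing involution of `R`, and `a'a = 0 ⇒ a = 0` on `R` because it holds on
`D` (★ `eq_zero_of_apply_mul_self`); the nilpotent-radical argument (★ `isSemisimpleRing_of_star_mul_self`) concludes.  (The trace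
positivity itself need not restrict to `R`; it is not used.) [cite: MumfordAV1970, §21 Thm. 1] [cite: MilneCM2006, Ch. I §1 Prop. 1.36 (p. 20)] -/
theorem IsPositiveAntiInvolution.isSemisimpleRing_subalgebra [Module.Finite ℚ D] (h : IsPositiveAntiInvolution D ι)
    (R : Subalgebra ℚ D) (hR : ∀ x ∈ R, ι x ∈ R) : IsSemisimpleRing R := by
  haveI : Module.Finite ℚ R := Module.Finite.of_injective R.val.toLinearMap Subtype.val_injective
  haveI : IsArtinianRing R := IsArtinianRing.of_finite ℚ R
  refine Literature.RepresentationTheory.FiniteMonoids.InverseMonoidAlgebra.isSemisimpleRing_of_star_mul_self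
    (fun a : R => (⟨ι (a : D), hR a a.2⟩ : R)) (fun a b => Subtype.ext ?_) (fun a => Subtype.ext ?_) fun a ha => Subtype.ext ?_
  · change ι ((a : D) * (b : D)) = ι (b : D) * ι (a : D)
    exact h.map_mul a b
  · change ι (ι (a : D)) = (a : D)
    exact h.apply_apply a
  · have ha' : ι (a : D) * (a : D) = 0 := by
      have := congrArg Subtype.val ha
      simpa only [Subalgebra.coe_mul, Subalgebra.coe_zero] using this
    exact h.eq_zero_of_apply_mul_self ha'

/-- **The `ℚ`-algebra generated by a set stable under a positive anti-involution is semisimple**: if `(D, ')` is finite-dimensional with a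
positive anti-involution and `s' ∈ ℚ[S]` for every `s ∈ S`, then `ℚ[S] = Algebra.adjoin ℚ S` is semisimple (§1 + `isSemisimpleRing_subalgebra`).
With `D = End⁰` of a polarised complex abelian variety, `'` the Rosati involution and `S` a set of Hecke correspondences this is the
semisimplicity of the Hecke algebra image ([MumfordAV1970] §21 applied as in [Lange2023] §2.6). [cite: MumfordAV1970, §21 Thm. 1]
[cite: MilneCM2006, Ch. I §1 Prop. 1.36 (p. 20)] [cite: Lange2023AbelianVarietiesComplex, §2.4.1 Thm. 2.4.9 and §2.6.2] -/
theorem IsPositiveAntiInvolution.isSemisimpleRing_adjoin [Module.Finite ℚ D] (h : IsPositiveAntiInvolution D ι) {S : Set D}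
    (hS : ∀ s ∈ S, ι s ∈ Algebra.adjoin ℚ S) : IsSemisimpleRing (Algebra.adjoin ℚ S) :=
  h.isSemisimpleRing_subalgebra (Algebra.adjoin ℚ S) fun _ hx => h.toIsAntiInvolution.apply_mem_adjoin_of_forall_mem hS hx

/-- Variant with the stability hypothesis on `S` itself (`S' ⊆ S`). [cite: MumfordAV1970, §21 Thm. 1] [cite: MilneCM2006, Ch. I §1 Prop. 1.36 (p. 20)] -/
theorem IsPositiveAntiInvolution.isSemisimpleRing_adjoin_of_mapsTo [Module.Finite ℚ D] (h : IsPositiveAntiInvolution D ι) {S : Set D}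
    (hS : Set.MapsTo ι S S) : IsSemisimpleRing (Algebra.adjoin ℚ S) :=
  h.isSemisimpleRing_adjoin fun _ hs => Algebra.subset_adjoin (hS hs)


end StableAdjoin

end Literature.RingTheory.CentralSimple
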